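import Mathlib
import HarnessLib

/-!
# `K[p]`-linear independence of power series survives extension of scalars (CDT §2.1)

`Literature/RingTheory/PowerSeries/LinearIndependenceBaseChange.lean`. Everything here is PROVED
(no definition, no named fact). In the proof of their auxiliary construction (Lemma 2.1.1),
F. Calegari, V. Dimitrov, Y. Tang, *The unbounded denominators conjecture* (J. Amer. Math. Soc.
**38** (2025), 627–702; arXiv:2109.09040), §2.1, need that the `d`-fold products
`∏_s f_{i_s}(x_s)` of `ℚ(p(x))`-linearly independent power series `f₁, …, f_m ∈ ℚ⟦x⟧` are
`ℚ(p(x₁), …, p(x_d))`-linearly independent ("an easy induction argument on the dimension `d`").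
The induction step rests on the following extension-of-scalars statement, which we prove for an
arbitrary commutative algebra `A` over a field `K` (in the induction, `A = K⟦x₁, …, x_d⟧`):

  if `f₁, …, f_m ∈ K⟦y⟧` admit no nontrivial relation `∑ Q_i(p) f_i = 0` with `Q_i ∈ K[X]`,
  then they admit no nontrivial relation `∑ Q_i(p) f_i = 0` in `A⟦y⟧` with `Q_i ∈ A[X]`

(`linearIndependent_aeval_baseChange`). Proof: apply an arbitrary `K`-linear functional
`ℓ : A → K` coefficientwise (`coeffwise`); this turns an `A[X]`-relation into a `K[X]`-relation
whose coefficients are the `ℓ`-images of the original ones, and functionals separate points.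

## References

* [CalegariDimitrovTang2025] F. Calegari, V. Dimitrov, Y. Tang, The unbounded denominators
  conjecture, J. Amer. Math. Soc. 38 (2025), no. 3, 627–702, §2.1, end of the proof of
  Lemma 2.1.1; arXiv:2109.09040.
-/

noncomputable section

open PowerSeries Polynomial Finset

namespace Literature.RingTheory.PowerSeries

variable {K A : Type*} [Field K] [CommRing A] [Algebra K A]

/-! ### 1. Applying a linear functional coefficientwise -/

/-- The power series obtained by applying a `K`-linear functional `ℓ : A → K` to every
coefficient. [folklore] -/
theorem coeff_mk_dual (ℓ : Module.Dual K A) (g : PowerSeries A) (n : ℕ) :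
    coeff n (PowerSeries.mk fun k ↦ ℓ (coeff k g)) = ℓ (coeff n g) := by
  rw [coeff_mk]

/-- Coefficientwise application of `ℓ` to `c • g` for `g ∈ K⟦y⟧` (base-changed to `A⟦y⟧`) and
`c ∈ A` gives `ℓ(c) • g`. [folklore] -/
theorem mk_dual_smul_map (ℓ : Module.Dual K A) (c : A) (g : PowerSeries K) :
    (PowerSeries.mk fun k ↦ ℓ (coeff k (c • PowerSeries.map (algebraMap K A) g))) = ℓ c • g := by
  ext n
  rw [coeff_mk, PowerSeries.coeff_smul, PowerSeries.coeff_map, smul_eq_mul, PowerSeries.coeff_smul,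
    smul_eq_mul, mul_comm c, ← Algebra.smul_def, map_smul, smul_eq_mul, mul_comm]

/-- Coefficientwise application of `ℓ` to a finite double sum `∑_i ∑_k c_{ik} • g_{ik}`.
[folklore] -/
theorem mk_dual_sum_sum_smul_map (ℓ : Module.Dual K A) {ι : Type*} (s : Finset ι) (B : ℕ)
    (c : ι → ℕ → A) (g : ι → ℕ → PowerSeries K) :
    (PowerSeries.mk fun n ↦ ℓ (coeff n
        (∑ i ∈ s, ∑ k ∈ range B, c i k • PowerSeries.map (algebraMap K A) (g i k)))) =
      ∑ i ∈ s, ∑ k ∈ range B, ℓ (c i k) • g i k := by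
  ext n
  rw [coeff_mk]
  simp only [map_sum]
  refine sum_congr rfl fun i _ ↦ sum_congr rfl fun k _ ↦ ?_
  rw [← coeff_mk_dual ℓ (c i k • PowerSeries.map (algebraMap K A) (g i k)) n, mk_dual_smul_map]

/-! ### 2. The base-change statement -/

/-- **`K[p]`-linear independence survives base change** (CDT §2.1, the induction step for the
linear independence of `∏_s f_{i_s}(x_s)`): let `f : ι → K⟦y⟧` (finitely many power series) and
`p ∈ K⟦y⟧`, and suppose that every relation `∑_i Q_i(p) · f_i = 0` with polynomials `Q_i ∈ K[X]`
is trivial. Then for every commutative `K`-algebra `A`, every relation `∑_i Q_i(p) · f_i = 0` in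
`A⟦y⟧` with polynomials `Q_i ∈ A[X]` is trivial.
[cite: CalegariDimitrovTang2025, §2.1, end of the proof of Lemma 2.1.1] -/
theorem linearIndependent_aeval_baseChange {ι : Type*} [Fintype ι] (f : ι → PowerSeries K)
    (p : PowerSeries K)
    (hind : ∀ Q : ι → K[X], ∑ i, aeval p (Q i) * f i = 0 → ∀ i, Q i = 0)
    (Q : ι → A[X])
    (hrel : ∑ i, aeval (PowerSeries.map (algebraMap K A) p) (Q i) *
      PowerSeries.map (algebraMap K A) (f i) = 0) :
    ∀ i, Q i = 0 := by
  classical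
  -- a uniform degree bound
  set B : ℕ := (Finset.univ.sup fun i ↦ (Q i).natDegree) + 1 with hB
  have hdeg : ∀ i, (Q i).natDegree < B := fun i ↦
    Nat.lt_succ_of_le (Finset.le_sup (f := fun i ↦ (Q i).natDegree) (Finset.mem_univ i))
  set φ := algebraMap K A with hφ
  -- the relation, expanded: `∑_i ∑_{k<B} c_{ik} • (p^k f_i) = 0` in `A⟦y⟧`
  have hrel' : ∑ i, ∑ k ∈ range B, (Q i).coeff k •
      PowerSeries.map φ (p ^ k * f i) = 0 := by
    rw [← hrel]
    refine sum_congr rfl fun i _ ↦ ?_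
    rw [aeval_eq_sum_range' (hdeg i), sum_mul]
    refine sum_congr rfl fun k _ ↦ ?_
    rw [map_mul, map_pow, smul_mul_assoc]
  -- every functional kills every coefficient
  suffices hcoef : ∀ (ℓ : Module.Dual K A) (i : ι) (k : ℕ), k < B → ℓ ((Q i).coeff k) = 0 by
    intro i
    ext k
    rw [coeff_zero]
    rcases lt_or_ge k B with hk | hk
    · exact (Module.forall_dual_apply_eq_zero_iff K ((Q i).coeff k)).mp fun ℓ ↦ hcoef ℓ i k hk
    · exact coeff_eq_zero_of_natDegree_lt ((hdeg i).trans_le hk)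
  intro ℓ
  -- apply `ℓ` coefficientwise to the relation
  have h1 : (PowerSeries.mk fun n ↦ ℓ (coeff n (∑ i, ∑ k ∈ range B, (Q i).coeff k •
      PowerSeries.map φ (p ^ k * f i)))) = PowerSeries.mk fun n ↦ ℓ (coeff n (0 : PowerSeries A)) := by
    rw [hrel']
  rw [mk_dual_sum_sum_smul_map ℓ Finset.univ B (fun i k ↦ (Q i).coeff k) (fun i k ↦ p ^ k * f i)]
    at h1
  have h0 : (PowerSeries.mk fun n ↦ ℓ (coeff n (0 : PowerSeries A))) = 0 := by
    ext n; rw [coeff_mk, map_zero, map_zero, map_zero]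
  rw [h0] at h1
  -- this is the `K[X]`-relation with polynomials `q_i := ∑_{k<B} ℓ(c_{ik}) X^k`
  set q : ι → K[X] := fun i ↦ ∑ k ∈ range B, monomial k (ℓ ((Q i).coeff k)) with hq
  have hqrel : ∑ i, aeval p (q i) * f i = 0 := by
    rw [← h1]
    refine sum_congr rfl fun i _ ↦ ?_
    rw [hq]
    simp only [map_sum, aeval_monomial, sum_mul]
    refine sum_congr rfl fun k _ ↦ ?_
    rw [Algebra.smul_def, mul_assoc]
  have hq0 := hind q hqrel
  intro i k hk
  have h2 := congrArg (fun P : K[X] ↦ P.coeff k) (hq0 i)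
  simp only [hq, finsetSum_coeff, Polynomial.coeff_monomial, Polynomial.coeff_zero] at h2
  rw [Finset.sum_eq_single k (fun x _ hx ↦ if_neg hx)
    (fun hk' ↦ absurd (mem_range.mpr hk) hk'), if_pos rfl] at h2
  exact h2

end Literature.RingTheory.PowerSeries
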